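import Mathlib
import Literature.Geometry.Lorentzian.CauchyDevelopment
import Literature.Geometry.Lorentzian.KerrConvergence
import HarnessLib

/-!
# The final-era package of a Cauchy development (hypothesis structure)

A **final era** of a Cauchy development `𝒟 = (M, g, τ, ι, ν)` of `3`-dimensional initial data
is the late-time picture expected of a generic asymptotically flat vacuum spacetime after its
last strong-field event (final state conjecture: "vacuum spacetimes arising from generic
asymptotically flat Cauchy data … will either disperse or settle down to finitely many rotating
Kerr black holes moving away from each other", Dafermos–Luk, arXiv:1710.01722, p. 8 and
Conjecture 1; Penrose 1982, Problem 12), organised as a weakly coupled `N`-body system: `N`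
rest-frame Kerr–Schild near-zone charts `Ψᵢ` with sub-extremal labels `(Mᵢ, aᵢ)` and one flat
chart `Ψ₀`, all late-time charts (`Spacetime.IsLateChart`, `KerrConvergence`) into the
self-determined exterior `O = J⁺(ι X) ∩ I⁻(charted late sets)`, together with `C²` worldlines
`ξᵢ : ℝ → ℝ³` of the holes in the flat chart which obey a **near-Newtonian modulation law**
`‖ξ̈ᵢ + Σ_{j ≠ i} Mⱼ (ξᵢ − ξⱼ)/dᵢⱼ³‖ ≤ κ Σ_{j ≠ i} (Mⱼ/dᵢⱼ²)(‖ξ̇ᵢ‖² + ‖ξ̇ⱼ‖² + (Σₗ Mₗ)/dᵢⱼ) + β(t)`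
(`dᵢⱼ = ‖ξᵢ − ξⱼ‖`) with integrable slack `β ≥ 0` — the Newtonian `N`-body acceleration up
to a slack of the shape of the first post-Newtonian bracket of the harmonic-coordinates
equations of motion
(Einstein–Infeld–Hoffmann, Ann. Math. 39 (1938); Blanchet, Living Rev. Relativ. 27 (2024),
§3.2.2, eq. (339): `a₁ = −G m₂ n₁₂/r₁₂² + c⁻² {(5G²m₁m₂ + 4G²m₂²)/r₁₂³ + (G m₂/r₁₂²)(v-quadratic)}
n₁₂ + …`) — a separation floor `δ`, a subluminal Lipschitz bound `V < 1`, `C⁰` Kerr-closeness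
of every near zone `{rᵢ ≤ 2ρ₀}`, `C²` convergence of eventually isolated holes (effacement),
chart-localisation and clock-comparison clauses relating the hole charts to the flat chart,
and exhaustion of `O` by the flat late region and the certified zones.

**No printed formulation exists**: like `FinalStateDecomposition` (`KerrConvergence`), this is
a *hypothesis structure* recording the data and the clauses a statement consumes. It was
requested (ledger item `defn-FinalEraPackage`) by the route `DissipativeFinalMotions` on the
summit `FinalStateConjecture`, whose three package-bearing items (`FinalEraGeneric` under `∃`,
`RadiativeLyapunovBudget` and `DispersingCapture` under `∀`) carry the same 18 binders and the
same 29 conjuncts inline, verbatim-identical; this file bundles exactly those binders (as data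
fields, with the binders' names) and those conjuncts (as `Prop` fields), so that the items can
be restated compactly over the structure.

## Contents (namespace `Literature.Geometry.Lorentzian`)

* `CauchyDevelopment.IsFinalEra 𝒟 N M a T δ V C₁ C₂ ρ₀ κ ξ β U₀ B₀ B Ψ₀ Ψ O` — the **inline
  form**: the 29-conjunct conjunction, verbatim the text of the route items with the single
  forced change that `Summit.FinalStateConjecture.exteriorOf 𝒟 U` (a summit-side auxiliary a
  Literature file cannot import, CONVENTIONS §2) is replaced by its body
  `J⁺(ι X) ∩ I⁻(U) = 𝒟.metric.causalFuture 𝒟.timeOrientation (range 𝒟.embed) ∩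
  𝒟.metric.chronologicalPast 𝒟.timeOrientation U` (itself verbatim `Development.exteriorOf`,
  `FinalState`), to which it is definitionally equal (`Iff.rfl`/`rfl` close the comparison on
  the summit side).
* `FinalEraPackage 𝒟` — the **bundled form**: a structure with the 18 data fields
  `N, M, a, T, δ, V, C₁, C₂, ρ₀, κ, ξ, β, U₀, B₀, B, Ψ₀, Ψ, O` and the 29 clauses as named
  `Prop` fields, labelled (O), (B), (P), (W1)–(W4), (F1)–(F3), (H1)–(H3), (X1)–(X4), (EX) as in
  the request.
* the dictionary between the two: `FinalEraPackage.isFinalEra` (bundled ⇒ inline),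
  `FinalEraPackage.ofIsFinalEra` (inline ⇒ bundled; data projections reduce by `rfl`),
  `FinalEraPackage.ofIsFinalEra_isFinalEra` (round trip, `rfl`),
  `FinalEraPackage.nonempty_iff` (`Nonempty (FinalEraPackage 𝒟) ↔ ∃ …, IsFinalEra …`, for the
  `∃`-item), `FinalEraPackage.forall_iff` / `FinalEraPackage.exists_iff` (quantification over
  packages versus quantification over the 18 binders under the inline hypothesis, for the
  `∀`-items), and `FinalEraPackage.forall_iff_forall_ofIsFinalEra`.

## Design choices

* **Carrier.** The package is stated for `𝒟 : CauchyDevelopment D` (the repaired development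
  structure of `CauchyDevelopment.lean`), exactly like the summit's auxiliaries
  `Summit.FinalStateConjecture.exteriorOf` / `HasCompleteNullInfinity`; the route items
  quantify over `𝒟 : VacuumCauchyDevelopment D` and apply it as
  `FinalEraPackage 𝒟.toCauchyDevelopment` (the vacuum equation plays no role in the clauses;
  `𝒟.toSpacetime`, `𝒟.carrier`, `𝒟.metric` of a `VacuumCauchyDevelopment` are by definition
  those of its `toCauchyDevelopment`, so the inline texts agree syntactically after
  elaboration).
* **Verbatim.** Field types are the route's conjunct texts token for token (outer parentheses
  of a conjunct dropped, `Literature.Geometry.Lorentzian.` prefixes dropped inside the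
  namespace); in particular the two background EQUATIONS `B₀ = Minkowski.backgroundOn U₀` and
  `B = fun i ↦ Kerr.background (M i) (a i)` are kept as fields (the route: "so provers `subst`
  them") rather than being substituted into the types of `Ψ₀`, `Ψ`, which would change the
  binder structure the items quantify over.
* **Nothing is asserted.** Every declaration here is a definition or a proved structural
  lemma; whether generic developments possess a final era is the content of the route item
  `FinalEraGeneric` (an open problem), not of this file.

## Mathlib

Mathlib has no Lorentzian geometry (see `KerrConvergence`); used here: `ContDiff`, `deriv`,
`MeasureTheory.IntegrableOn`, `Finset.sum`, `TopologicalSpace.Opens`, `ENNReal.ofReal`, `Set`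
algebra. Nothing duplicates Mathlib or the tree
(`lean search --decl 'FinalEra|IsFinalEra|EraPackage'`: the only hits are the route items).

## References

* M. Dafermos, J. Luk, *The interior of dynamical vacuum black holes I*, arXiv:1710.01722,
  p. 8 and Conjecture 1 (final state conjecture; Kerr exteriors `J⁻(𝓘⁺)`).
* R. Penrose, *Some unsolved problems in classical general relativity* (1982), Problem 12.
* A. Einstein, L. Infeld, B. Hoffmann, *The gravitational equations and the problem of
  motion*, Ann. of Math. 39 (1938), 65–100 (post-Newtonian equations of motion of `N` bodies).
* L. Blanchet, *Post-Newtonian theory for gravitational waves*, Living Rev. Relativ. 27 (2024)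
  4 = arXiv:1310.1528, §3.2.2, eq. (339) (harmonic-coordinates equations of motion; the `1PN`
  bracket `(G m₂/r₁₂²)(v², G m/r₁₂)`).
* M. Dafermos, G. Holzegel, I. Rodnianski, M. Taylor, arXiv:2104.08222, §1 (late-time charts,
  near zones; via `KerrConvergence`).
-/

noncomputable section

open Set TopologicalSpace Filter MeasureTheory
open scoped Manifold ContDiff Topology ENNReal

universe u

namespace Literature.Geometry.Lorentzian

variable {X : Type u} [TopologicalSpace X] [ChartedSpace E3 X] [IsManifold (𝓡 3) ∞ X]
  [ConnectedSpace X] {D : InitialDataSet (𝓡 3) X}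

/-! ### The inline form -/

/-- **The tuple `(N, M, a, T, δ, V, C₁, C₂, ρ₀, κ, ξ, β, U₀, B₀, B, Ψ₀, Ψ, O)` is a final era of
the Cauchy development `𝒟`** — the INLINE form of `FinalEraPackage 𝒟`: the conjunction of its
29 clauses (O), (B), (P), (W1)–(W4), (F1)–(F3), (H1)–(H3), (X1)–(X4), (EX), verbatim the common
hypothesis text of the items `FinalEraGeneric` / `RadiativeLyapunovBudget` / `DispersingCapture`
of the route `DissipativeFinalMotions` (summit `FinalStateConjecture`), except that the
summit-side auxiliary `Summit.FinalStateConjecture.exteriorOf 𝒟 U` is replaced by its body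
`J⁺(ι X) ∩ I⁻(U)` (definitionally equal). See `FinalEraPackage` for the meaning of each clause
and `FinalEraPackage.nonempty_iff` / `forall_iff` / `exists_iff` for the dictionary. No printed
formulation exists (hypothesis predicate; final state picture of Dafermos–Luk, arXiv:1710.01722,
p. 8, with an Einstein–Infeld–Hoffmann-type modulation law, Blanchet 2024, §3.2.2, eq. (339)).
[cite: DafermosLuk2017, p. 8 and Conjecture 1] [cite: Blanchet2024, §3.2.2, eq. (339)] -/
def CauchyDevelopment.IsFinalEra (𝒟 : CauchyDevelopment D) (N : ℕ) (M a : Fin N → ℝ)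
    (T δ V C₁ C₂ ρ₀ κ : ℝ) (ξ : Fin N → ℝ → E3) (β : ℝ → ℝ) (U₀ : Opens E4)
    (B₀ : ModelBackground) (B : Fin N → ModelBackground) (Ψ₀ : B₀.domain → 𝒟.carrier)
    (Ψ : (i : Fin N) → (B i).domain → 𝒟.carrier) (O : Set 𝒟.carrier) : Prop :=
  O = 𝒟.metric.causalFuture 𝒟.timeOrientation (range 𝒟.embed) ∩
    𝒟.metric.chronologicalPast 𝒟.timeOrientation
      (Ψ₀ '' B₀.lateRegion T ∪ ⋃ i, Ψ i '' (B i).lateRegion T) ∧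
  B₀ = Minkowski.backgroundOn U₀ ∧ (B = fun i ↦ Kerr.background (M i) (a i)) ∧
  (∀ i, Kerr.IsSubextremal (M i) (a i)) ∧ 0 < δ ∧ 0 ≤ V ∧ V < 1 ∧ 0 ≤ C₁ ∧ 1 ≤ C₂ ∧ 0 < ρ₀ ∧
  0 ≤ κ ∧ (∀ i, ContDiff ℝ 2 (ξ i)) ∧ (∀ t, T ≤ t → ∀ i j, i ≠ j → δ ≤ ‖ξ i t - ξ j t‖) ∧
  (∀ i s t, T ≤ s → s ≤ t → ‖ξ i t - ξ i s‖ ≤ V * (t - s)) ∧ IntegrableOn β (Ici T) ∧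
  (∀ t, T ≤ t → 0 ≤ β t) ∧
  (∀ t, T ≤ t → ∀ i, ‖deriv (deriv (ξ i)) t +
      ∑ j ∈ Finset.univ.erase i, (M j / ‖ξ i t - ξ j t‖ ^ 3) • (ξ i t - ξ j t)‖ ≤
    κ * (∑ j ∈ Finset.univ.erase i, M j / ‖ξ i t - ξ j t‖ ^ 2 *
      (‖deriv (ξ i) t‖ ^ 2 + ‖deriv (ξ j) t‖ ^ 2 + (∑ l, M l) / ‖ξ i t - ξ j t‖)) + β t) ∧
  𝒟.toSpacetime.IsLateChart B₀ O T Ψ₀ ∧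
  {y : E4 | T < y 0 ∧ ∀ i, ρ₀ < ‖E4.spatial y - ξ i (y 0)‖} ⊆ (B₀.domain : Set E4) ∧
  (∀ ε : ℝ, 0 < ε → ∃ ϱ T' : ℝ, ∀ τ, T' ≤ τ →
    supCkENorm (Subtype.val '' {y : B₀.domain | y.1 0 = τ ∧ ∀ i, ϱ ≤ ‖E4.spatial y.1 - ξ i τ‖})
      2 (𝒟.toSpacetime.deviationExtend B₀ Ψ₀) ≤ ENNReal.ofReal ε) ∧
  (∀ i, 𝒟.toSpacetime.IsLateChart (B i) O T (Ψ i)) ∧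
  (∀ i τ, T ≤ τ →
    𝒟.toSpacetime.truncDeviationCk (B i) (Ψ i) 0 (2 * ρ₀) τ ≤ ENNReal.ofReal (1 / 100)) ∧
  (∀ i (R ε : ℝ), 0 < ε → ∃ D' : ℝ, ∀ T' : ℝ,
    (∀ t, T' ≤ t → ∀ j, j ≠ i → D' ≤ ‖ξ i t - ξ j t‖) → ∃ T'' : ℝ, ∀ τ, T'' ≤ τ →
      𝒟.toSpacetime.truncDeviationCk (B i) (Ψ i) 2 R τ ≤ ENNReal.ofReal ε) ∧
  (∀ i j, i ≠ j → Ψ i '' (B i).lateRegion T ∩ Ψ j '' (B j).lateRegion T ⊆ range Ψ₀) ∧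
  (∀ i (x : (B i).domain) (y : B₀.domain), T < x.1 0 → Ψ i x = Ψ₀ y →
    ‖E4.spatial y.1 - ξ i (y.1 0)‖ ≤ C₂ * (B i).radius x.1 + C₁) ∧
  (∀ i (R : ℝ), ∃ T₃ : ℝ, ∀ y : B₀.domain, T₃ < y.1 0 → ‖E4.spatial y.1 - ξ i (y.1 0)‖ ≤ R →
    ∃ x : (B i).domain, Ψ i x = Ψ₀ y ∧ T < x.1 0 ∧ (B i).radius x.1 ≤ C₂ * R + C₁) ∧
  (∀ i (t₀ : ℝ), ∃ τ' : ℝ,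
    Ψ i '' (B i).lateRegion τ' ∩ Ψ₀ '' {y : B₀.domain | y.1 0 ≤ t₀} = ∅) ∧
  (∀ i (τ' R : ℝ), ∃ t₀ : ℝ, Ψ₀ '' {y : B₀.domain | t₀ < y.1 0} ∩
    Ψ i '' {x : (B i).domain | x.1 0 ≤ τ' ∧ (B i).radius x.1 ≤ R} = ∅) ∧
  (∀ τ₁, T < τ₁ →
    O \ (Ψ₀ '' B₀.lateRegion τ₁ ∪ ⋃ i, Ψ i '' (B i).truncLateRegion τ₁ (2 * ρ₀)) ⊆
      𝒟.toSpacetime.metric.causalPast 𝒟.toSpacetime.timeOrientation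
        (Ψ₀ '' B₀.timeSlab τ₁ ∪ ⋃ i, Ψ i '' (B i).truncTimeSlab (2 * ρ₀) τ₁))

/-! ### The bundled form -/

/-- **Hypothesis structure: a final-era package** of the Cauchy development `𝒟` of
`3`-dimensional initial data — the late-time `N`-body picture of the final state conjecture
("settle down to finitely many rotating Kerr black holes moving away from each other",
Dafermos–Luk, arXiv:1710.01722, p. 8; Penrose 1982, Problem 12) in consequence form over the
vocabulary of `KerrConvergence`. DATA (the 18 binders of the route items, same names): the
number of holes `N`; Kerr labels `M a : Fin N → ℝ`; a late time `T`; constants `δ` (separation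
floor), `V` (speed bound), `C₁, C₂` (chart localisation), `ρ₀` (near-zone radius), `κ`
(post-Newtonian slack); worldlines `ξ : Fin N → ℝ → E3` of the holes in the flat chart; a slack
function `β : ℝ → ℝ`; the flat domain `U₀ : Opens E4`; backgrounds `B₀` (flat) and
`B : Fin N → ModelBackground` (holes); chart maps `Ψ₀ : B₀.domain → M`, `Ψ i : (B i).domain → M`;
and the region `O ⊆ M`. CLAUSES (29 `Prop` fields, verbatim the route's conjuncts): (O) `O` is
the self-determined exterior `J⁺(ι X) ∩ I⁻(Ψ₀(late T) ∪ ⋃ᵢ Ψᵢ(late T))`; (B) `B₀` is Minkowski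
on `U₀` and `B i` is rest-frame Kerr–Schild `(Mᵢ, aᵢ)` (equations); (P) sub-extremal labels
and the signs/ranges of the constants; (W1)–(W4) `C²` worldlines, `δ`-separation after `T`,
`V`-Lipschitz on `[T, ∞)`, and the near-Newtonian modulation law
`‖ξ̈ᵢ + Σ_{j≠i} Mⱼ(ξᵢ − ξⱼ)/‖ξᵢ − ξⱼ‖³‖ ≤ κ Σ_{j≠i} (Mⱼ/dᵢⱼ²)(‖ξ̇ᵢ‖² + ‖ξ̇ⱼ‖² + (Σₗ Mₗ)/dᵢⱼ) + β t`
with `β ≥ 0` integrable on `[T, ∞)` (Einstein–Infeld–Hoffmann 1938; the slack has the shape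
of the `1PN` bracket of Blanchet 2024, eq. (339)); (F1)–(F3) `Ψ₀` is a late chart into `O`,
its domain contains `{t > T}` minus the `ρ₀`-tubes about the `ξᵢ`, and `Ψ₀^* g → η` in `C²`
beyond flat distance `ϱ(ε)` from all holes; (H1)–(H3) each `Ψᵢ` is a late chart into `O`, its
near zone `{rᵢ ≤ 2ρ₀}` is `1/100`-close in `C⁰` to Kerr `(Mᵢ, aᵢ)` at all times `≥ T`, and an
eventually isolated hole converges in `C²` on every `{rᵢ ≤ R}` (effacement); (X1)–(X4) hole
charts overlap only inside `range Ψ₀`, two-sided chart localisation `|x̲ − ξᵢ(t)| ≤ C₂ rᵢ + C₁`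
and conversely, and qualitative comparison of the hole clocks `t*ᵢ` with the flat clock `x⁰`;
(EX) for every chart time `τ₁ > T` the flat late region and the certified zones exhaust `O` up
to the causal past of the certified slab at `τ₁`. **No printed formulation exists**
(cf. `FinalStateDecomposition`); requested by the route `DissipativeFinalMotions` (summit
`FinalStateConjecture`), whose items restate over it via `nonempty_iff` / `forall_iff`.
[cite: DafermosLuk2017, p. 8 and Conjecture 1]
[cite: Blanchet2024, §1 (item 1: Einstein et al. 1938) and §3.2.2, eq. (339)] -/
structure FinalEraPackage (𝒟 : CauchyDevelopment D) where
  /-- The number `N` of final black holes. -/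
  N : ℕ
  /-- The Kerr masses `Mᵢ` of the holes. -/
  M : Fin N → ℝ
  /-- The Kerr specific angular momenta `aᵢ` of the holes. -/
  a : Fin N → ℝ
  /-- The late time `T` after which the era is in force. -/
  T : ℝ
  /-- The separation floor `δ`. -/
  δ : ℝ
  /-- The speed (Lipschitz) bound `V` of the worldlines. -/
  V : ℝ
  /-- The additive chart-localisation constant `C₁`. -/
  C₁ : ℝ
  /-- The multiplicative chart-localisation constant `C₂`. -/
  C₂ : ℝ
  /-- The near-zone radius `ρ₀` (certified zones are `{rᵢ ≤ 2ρ₀}`). -/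
  ρ₀ : ℝ
  /-- The post-Newtonian slack constant `κ` of the modulation law. -/
  κ : ℝ
  /-- The worldlines `ξᵢ : ℝ → ℝ³` of the holes in the flat chart (flat time parameter). -/
  ξ : Fin N → ℝ → E3
  /-- The integrable slack `β(t)` of the modulation law. -/
  β : ℝ → ℝ
  /-- The coordinate domain `U₀ ⊆ E4` of the flat chart. -/
  U₀ : Opens E4
  /-- The flat reference background (pinned to `Minkowski.backgroundOn U₀` by `B₀_eq`). -/
  B₀ : ModelBackground
  /-- The hole reference backgrounds (pinned to `Kerr.background (M i) (a i)` by `B_eq`). -/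
  B : Fin N → ModelBackground
  /-- The flat (radiation-zone) chart map. -/
  Ψ₀ : B₀.domain → 𝒟.carrier
  /-- The near-zone chart map of hole `i`. -/
  Ψ : (i : Fin N) → (B i).domain → 𝒟.carrier
  /-- The exterior region carrying the charts. -/
  O : Set 𝒟.carrier
  /-- (O) The region `O` IS the self-determined exterior `J⁺(ι X) ∩ I⁻(charted late sets)`:
  verbatim the body of `Summit.FinalStateConjecture.exteriorOf` / `Development.exteriorOf` at
  `U = Ψ₀(late T) ∪ ⋃ᵢ Ψᵢ(late T)`. -/
  O_eq :
    O = 𝒟.metric.causalFuture 𝒟.timeOrientation (range 𝒟.embed) ∩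
      𝒟.metric.chronologicalPast 𝒟.timeOrientation
        (Ψ₀ '' B₀.lateRegion T ∪ ⋃ i, Ψ i '' (B i).lateRegion T)
  /-- (B) The flat background is Minkowski on `U₀` (an equation, so that users may `subst`). -/
  B₀_eq : B₀ = Minkowski.backgroundOn U₀
  /-- (B) The hole backgrounds are the rest-frame Kerr–Schild backgrounds of the labels
  `(Mᵢ, aᵢ)` (an equation, so that users may `subst`). -/
  B_eq : B = fun i ↦ Kerr.background (M i) (a i)
  /-- (P) Every label is sub-extremal, `|aᵢ| < Mᵢ`. -/
  isSubextremal : ∀ i, Kerr.IsSubextremal (M i) (a i)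
  /-- (P) The separation floor is positive. -/
  δ_pos : 0 < δ
  /-- (P) The speed bound is non-negative. -/
  V_nonneg : 0 ≤ V
  /-- (P) The speed bound is subluminal, `V < 1`. -/
  V_lt_one : V < 1
  /-- (P) The additive localisation constant is non-negative. -/
  C₁_nonneg : 0 ≤ C₁
  /-- (P) The multiplicative localisation constant is at least `1`. -/
  one_le_C₂ : 1 ≤ C₂
  /-- (P) The near-zone radius is positive. -/
  ρ₀_pos : 0 < ρ₀
  /-- (P) The post-Newtonian slack constant is non-negative. -/
  κ_nonneg : 0 ≤ κ
  /-- (W1) The worldlines are `C²`. -/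
  contDiff_ξ : ∀ i, ContDiff ℝ 2 (ξ i)
  /-- (W2) Separation floor: distinct holes stay `δ`-apart after time `T`. -/
  le_norm_sub : ∀ t, T ≤ t → ∀ i j, i ≠ j → δ ≤ ‖ξ i t - ξ j t‖
  /-- (W3) The worldlines are `V`-Lipschitz on `[T, ∞)`. -/
  norm_sub_le : ∀ i s t, T ≤ s → s ≤ t → ‖ξ i t - ξ i s‖ ≤ V * (t - s)
  /-- (W4) The slack `β` is integrable on `[T, ∞)`. -/
  integrableOn_β : IntegrableOn β (Ici T)
  /-- (W4) The slack `β` is non-negative on `[T, ∞)`. -/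
  β_nonneg : ∀ t, T ≤ t → 0 ≤ β t
  /-- (W4) The near-Newtonian MODULATION LAW with post-Newtonian-type slack, for `t ≥ T`:
  `‖ξ̈ᵢ + Σ_{j≠i} Mⱼ(ξᵢ − ξⱼ)/dᵢⱼ³‖ ≤ κ Σ_{j≠i} (Mⱼ/dᵢⱼ²)(‖ξ̇ᵢ‖² + ‖ξ̇ⱼ‖² + (Σₗ Mₗ)/dᵢⱼ) + β t`,
  `dᵢⱼ = ‖ξᵢ(t) − ξⱼ(t)‖` (Einstein–Infeld–Hoffmann 1938; Blanchet 2024, §3.2.2, eq. (339)). -/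
  modulation : ∀ t, T ≤ t → ∀ i, ‖deriv (deriv (ξ i)) t +
      ∑ j ∈ Finset.univ.erase i, (M j / ‖ξ i t - ξ j t‖ ^ 3) • (ξ i t - ξ j t)‖ ≤
    κ * (∑ j ∈ Finset.univ.erase i, M j / ‖ξ i t - ξ j t‖ ^ 2 *
      (‖deriv (ξ i) t‖ ^ 2 + ‖deriv (ξ j) t‖ ^ 2 + (∑ l, M l) / ‖ξ i t - ξ j t‖)) + β t
  /-- (F1) The flat chart `Ψ₀` is a late-time chart into `O` after `T`. -/
  isLateChart_flat : 𝒟.toSpacetime.IsLateChart B₀ O T Ψ₀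
  /-- (F2) The flat domain contains every point of `{t > T}` at flat distance `> ρ₀` from all the
  `ξᵢ(t)` (the late half-space minus the closed `ρ₀`-tubes about the worldlines). -/
  setOf_subset_domain :
    {y : E4 | T < y 0 ∧ ∀ i, ρ₀ < ‖E4.spatial y - ξ i (y 0)‖} ⊆ (B₀.domain : Set E4)
  /-- (F3) `C²` flatness of `Ψ₀` far from the holes at late times: for every `ε > 0` there are
  `ϱ, T'` such that for `τ ≥ T'` the `C²` sup norm of `Ψ₀^* g − η` over the part of the flat slab
  `{x⁰ = τ}` at flat distance `≥ ϱ` from every `ξᵢ(τ)` is `≤ ε`. -/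
  supCkENorm_le : ∀ ε : ℝ, 0 < ε → ∃ ϱ T' : ℝ, ∀ τ, T' ≤ τ →
    supCkENorm (Subtype.val '' {y : B₀.domain | y.1 0 = τ ∧ ∀ i, ϱ ≤ ‖E4.spatial y.1 - ξ i τ‖})
      2 (𝒟.toSpacetime.deviationExtend B₀ Ψ₀) ≤ ENNReal.ofReal ε
  /-- (H1) Each hole chart `Ψᵢ` is a late-time chart into `O` after `T`. -/
  isLateChart : ∀ i, 𝒟.toSpacetime.IsLateChart (B i) O T (Ψ i)
  /-- (H2) `C⁰` closeness `≤ 1/100` of every near zone `{rᵢ ≤ 2ρ₀}` to its Kerr label at all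
  hole times `τ ≥ T`. -/
  truncDeviationCk_le : ∀ i τ, T ≤ τ →
    𝒟.toSpacetime.truncDeviationCk (B i) (Ψ i) 0 (2 * ρ₀) τ ≤ ENNReal.ofReal (1 / 100)
  /-- (H3) Effacement: for all `i`, `R` and `ε > 0` there is an isolation distance `D'` such
  that whenever hole `i` stays `D'`-far from every other hole after some `T'`, the `C²` deviation
  of `Ψᵢ^* g` from Kerr `(Mᵢ, aᵢ)` on `{rᵢ ≤ R}` is eventually `≤ ε`. -/
  effacement : ∀ i (R ε : ℝ), 0 < ε → ∃ D' : ℝ, ∀ T' : ℝ,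
    (∀ t, T' ≤ t → ∀ j, j ≠ i → D' ≤ ‖ξ i t - ξ j t‖) → ∃ T'' : ℝ, ∀ τ, T'' ≤ τ →
      𝒟.toSpacetime.truncDeviationCk (B i) (Ψ i) 2 R τ ≤ ENNReal.ofReal ε
  /-- (X1) Distinct holes' late images meet only inside the flat-charted region `range Ψ₀`. -/
  inter_subset_range :
    ∀ i j, i ≠ j → Ψ i '' (B i).lateRegion T ∩ Ψ j '' (B j).lateRegion T ⊆ range Ψ₀
  /-- (X2) Chart localisation: a point charted both by hole `i` at hole time `> T` and by the
  flat chart lies within flat distance `C₂ rᵢ + C₁` of the worldline `ξᵢ` at its flat time. -/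
  localisation : ∀ i (x : (B i).domain) (y : B₀.domain), T < x.1 0 → Ψ i x = Ψ₀ y →
    ‖E4.spatial y.1 - ξ i (y.1 0)‖ ≤ C₂ * (B i).radius x.1 + C₁
  /-- (X3) Converse localisation: for every `R`, late enough flat-charted points within flat
  distance `R` of `ξᵢ` are charted by hole `i` at hole time `> T` and radius `≤ C₂ R + C₁`. -/
  localisation_converse : ∀ i (R : ℝ), ∃ T₃ : ℝ, ∀ y : B₀.domain, T₃ < y.1 0 →
    ‖E4.spatial y.1 - ξ i (y.1 0)‖ ≤ R →
      ∃ x : (B i).domain, Ψ i x = Ψ₀ y ∧ T < x.1 0 ∧ (B i).radius x.1 ≤ C₂ * R + C₁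
  /-- (X4) Clock comparison, hole to flat: late enough hole-chart regions avoid every
  bounded-time part of the flat chart. -/
  clock_hole : ∀ i (t₀ : ℝ), ∃ τ' : ℝ,
    Ψ i '' (B i).lateRegion τ' ∩ Ψ₀ '' {y : B₀.domain | y.1 0 ≤ t₀} = ∅
  /-- (X4) Clock comparison, flat to hole: late enough flat-chart regions avoid every
  bounded-time, bounded-radius part of a hole chart. -/
  clock_flat : ∀ i (τ' R : ℝ), ∃ t₀ : ℝ, Ψ₀ '' {y : B₀.domain | t₀ < y.1 0} ∩
    Ψ i '' {x : (B i).domain | x.1 0 ≤ τ' ∧ (B i).radius x.1 ≤ R} = ∅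
  /-- (EX) Exhaustion: for every chart time `τ₁ > T`, every point of `O` neither in the flat
  late region `Ψ₀({x⁰ > τ₁})` nor in a certified zone `Ψᵢ({t*ᵢ > τ₁, rᵢ ≤ 2ρ₀})` lies in the
  causal past of the certified slab `Ψ₀({x⁰ = τ₁}) ∪ ⋃ᵢ Ψᵢ({t*ᵢ = τ₁, rᵢ ≤ 2ρ₀})`. -/
  exhaustion : ∀ τ₁, T < τ₁ →
    O \ (Ψ₀ '' B₀.lateRegion τ₁ ∪ ⋃ i, Ψ i '' (B i).truncLateRegion τ₁ (2 * ρ₀)) ⊆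
      𝒟.toSpacetime.metric.causalPast 𝒟.toSpacetime.timeOrientation
        (Ψ₀ '' B₀.timeSlab τ₁ ∪ ⋃ i, Ψ i '' (B i).truncTimeSlab (2 * ρ₀) τ₁)

namespace FinalEraPackage

variable {𝒟 : CauchyDevelopment D}

/-- Bundled ⇒ inline: the data of a final-era package satisfy the inline predicate
`CauchyDevelopment.IsFinalEra` (the 29 fields, reassembled as the route's conjunction).
Dafermos–Luk, arXiv:1710.01722, p. 8 (the picture; no printed formulation).
[cite: DafermosLuk2017, p. 8] -/
theorem isFinalEra (p : FinalEraPackage 𝒟) :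
    𝒟.IsFinalEra p.N p.M p.a p.T p.δ p.V p.C₁ p.C₂ p.ρ₀ p.κ p.ξ p.β p.U₀ p.B₀ p.B p.Ψ₀ p.Ψ p.O :=
  ⟨p.O_eq, p.B₀_eq, p.B_eq, p.isSubextremal, p.δ_pos, p.V_nonneg, p.V_lt_one, p.C₁_nonneg,
    p.one_le_C₂, p.ρ₀_pos, p.κ_nonneg, p.contDiff_ξ, p.le_norm_sub, p.norm_sub_le,
    p.integrableOn_β, p.β_nonneg, p.modulation, p.isLateChart_flat, p.setOf_subset_domain,
    p.supCkENorm_le, p.isLateChart, p.truncDeviationCk_le, p.effacement, p.inter_subset_range,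
    p.localisation, p.localisation_converse, p.clock_hole, p.clock_flat, p.exhaustion⟩

/-- Inline ⇒ bundled: a tuple satisfying `CauchyDevelopment.IsFinalEra` packages into a
`FinalEraPackage` with the same data (all data projections of `ofIsFinalEra h` reduce by `rfl`,
e.g. `(ofIsFinalEra h).ξ = ξ`; use `dsimp only [ofIsFinalEra]`). Dafermos–Luk, arXiv:1710.01722,
p. 8 (the picture; no printed formulation). [cite: DafermosLuk2017, p. 8] -/
def ofIsFinalEra {N : ℕ} {M a : Fin N → ℝ} {T δ V C₁ C₂ ρ₀ κ : ℝ} {ξ : Fin N → ℝ → E3}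
    {β : ℝ → ℝ} {U₀ : Opens E4} {B₀ : ModelBackground} {B : Fin N → ModelBackground}
    {Ψ₀ : B₀.domain → 𝒟.carrier} {Ψ : (i : Fin N) → (B i).domain → 𝒟.carrier}
    {O : Set 𝒟.carrier} (h : 𝒟.IsFinalEra N M a T δ V C₁ C₂ ρ₀ κ ξ β U₀ B₀ B Ψ₀ Ψ O) :
    FinalEraPackage 𝒟 where
  N := N
  M := M
  a := a
  T := T
  δ := δ
  V := V
  C₁ := C₁
  C₂ := C₂
  ρ₀ := ρ₀
  κ := κ
  ξ := ξ
  β := β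
  U₀ := U₀
  B₀ := B₀
  B := B
  Ψ₀ := Ψ₀
  Ψ := Ψ
  O := O
  O_eq := h.1
  B₀_eq := h.2.1
  B_eq := h.2.2.1
  isSubextremal := h.2.2.2.1
  δ_pos := h.2.2.2.2.1
  V_nonneg := h.2.2.2.2.2.1
  V_lt_one := h.2.2.2.2.2.2.1
  C₁_nonneg := h.2.2.2.2.2.2.2.1
  one_le_C₂ := h.2.2.2.2.2.2.2.2.1
  ρ₀_pos := h.2.2.2.2.2.2.2.2.2.1
  κ_nonneg := h.2.2.2.2.2.2.2.2.2.2.1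
  contDiff_ξ := h.2.2.2.2.2.2.2.2.2.2.2.1
  le_norm_sub := h.2.2.2.2.2.2.2.2.2.2.2.2.1
  norm_sub_le := h.2.2.2.2.2.2.2.2.2.2.2.2.2.1
  integrableOn_β := h.2.2.2.2.2.2.2.2.2.2.2.2.2.2.1
  β_nonneg := h.2.2.2.2.2.2.2.2.2.2.2.2.2.2.2.1
  modulation := h.2.2.2.2.2.2.2.2.2.2.2.2.2.2.2.2.1
  isLateChart_flat := h.2.2.2.2.2.2.2.2.2.2.2.2.2.2.2.2.2.1
  setOf_subset_domain := h.2.2.2.2.2.2.2.2.2.2.2.2.2.2.2.2.2.2.1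
  supCkENorm_le := h.2.2.2.2.2.2.2.2.2.2.2.2.2.2.2.2.2.2.2.1
  isLateChart := h.2.2.2.2.2.2.2.2.2.2.2.2.2.2.2.2.2.2.2.2.1
  truncDeviationCk_le := h.2.2.2.2.2.2.2.2.2.2.2.2.2.2.2.2.2.2.2.2.2.1
  effacement := h.2.2.2.2.2.2.2.2.2.2.2.2.2.2.2.2.2.2.2.2.2.2.1
  inter_subset_range := h.2.2.2.2.2.2.2.2.2.2.2.2.2.2.2.2.2.2.2.2.2.2.2.1
  localisation := h.2.2.2.2.2.2.2.2.2.2.2.2.2.2.2.2.2.2.2.2.2.2.2.2.1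
  localisation_converse := h.2.2.2.2.2.2.2.2.2.2.2.2.2.2.2.2.2.2.2.2.2.2.2.2.2.1
  clock_hole := h.2.2.2.2.2.2.2.2.2.2.2.2.2.2.2.2.2.2.2.2.2.2.2.2.2.2.1
  clock_flat := h.2.2.2.2.2.2.2.2.2.2.2.2.2.2.2.2.2.2.2.2.2.2.2.2.2.2.2.1
  exhaustion := h.2.2.2.2.2.2.2.2.2.2.2.2.2.2.2.2.2.2.2.2.2.2.2.2.2.2.2.2

/-- Round trip: re-packaging the inline form of a package gives the package back
(structure eta and proof irrelevance, `rfl`). [folklore] -/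
@[simp]
theorem ofIsFinalEra_isFinalEra (p : FinalEraPackage 𝒟) : ofIsFinalEra p.isFinalEra = p := rfl

/-- **Dictionary for the `∃`-item** (`FinalEraGeneric`): `𝒟` admits a final-era package iff
some tuple of the 18 binders satisfies the inline 29-conjunct form. Dafermos–Luk,
arXiv:1710.01722, p. 8 (the picture; no printed formulation). [cite: DafermosLuk2017, p. 8] -/
theorem nonempty_iff : Nonempty (FinalEraPackage 𝒟) ↔
    ∃ (N : ℕ) (M a : Fin N → ℝ) (T δ V C₁ C₂ ρ₀ κ : ℝ) (ξ : Fin N → ℝ → E3) (β : ℝ → ℝ)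
      (U₀ : Opens E4) (B₀ : ModelBackground) (B : Fin N → ModelBackground)
      (Ψ₀ : B₀.domain → 𝒟.carrier) (Ψ : (i : Fin N) → (B i).domain → 𝒟.carrier)
      (O : Set 𝒟.carrier), 𝒟.IsFinalEra N M a T δ V C₁ C₂ ρ₀ κ ξ β U₀ B₀ B Ψ₀ Ψ O :=
  ⟨fun ⟨p⟩ ↦ ⟨p.N, p.M, p.a, p.T, p.δ, p.V, p.C₁, p.C₂, p.ρ₀, p.κ, p.ξ, p.β, p.U₀, p.B₀, p.B, p.Ψ₀,
    p.Ψ, p.O, p.isFinalEra⟩,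
    fun ⟨_, _, _, _, _, _, _, _, _, _, _, _, _, _, _, _, _, _, h⟩ ↦ ⟨ofIsFinalEra h⟩⟩

/-- Quantifying a property of packages over all packages is quantifying it over all inline
tuples, re-packaged (structure eta). [folklore] -/
theorem forall_iff_forall_ofIsFinalEra {Q : FinalEraPackage 𝒟 → Prop} :
    (∀ p, Q p) ↔
      ∀ (N : ℕ) (M a : Fin N → ℝ) (T δ V C₁ C₂ ρ₀ κ : ℝ) (ξ : Fin N → ℝ → E3) (β : ℝ → ℝ)
        (U₀ : Opens E4) (B₀ : ModelBackground) (B : Fin N → ModelBackground)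
        (Ψ₀ : B₀.domain → 𝒟.carrier) (Ψ : (i : Fin N) → (B i).domain → 𝒟.carrier)
        (O : Set 𝒟.carrier) (h : 𝒟.IsFinalEra N M a T δ V C₁ C₂ ρ₀ κ ξ β U₀ B₀ B Ψ₀ Ψ O),
        Q (ofIsFinalEra h) :=
  ⟨fun H _ _ _ _ _ _ _ _ _ _ _ _ _ _ _ _ _ _ h ↦ H (ofIsFinalEra h), fun H p ↦
    H p.N p.M p.a p.T p.δ p.V p.C₁ p.C₂ p.ρ₀ p.κ p.ξ p.β p.U₀ p.B₀ p.B p.Ψ₀ p.Ψ p.O p.isFinalEra⟩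

/-- **Dictionary for the `∀`-items** (`RadiativeLyapunovBudget`, `DispersingCapture`): a
conclusion `Q` about the 18 binders holds for (the data of) every final-era package iff it
holds for every tuple of binders under the inline 29-conjunct hypothesis — the shape
`∀ N M a … O, ⟨conjuncts⟩ → Q N M a … O` of the route items. Dafermos–Luk, arXiv:1710.01722,
p. 8 (the picture; no printed formulation). [cite: DafermosLuk2017, p. 8] -/
theorem forall_iff
    {Q : ∀ (N : ℕ) (M a : Fin N → ℝ) (T δ V C₁ C₂ ρ₀ κ : ℝ) (ξ : Fin N → ℝ → E3) (β : ℝ → ℝ)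
      (U₀ : Opens E4) (B₀ : ModelBackground) (B : Fin N → ModelBackground)
      (Ψ₀ : B₀.domain → 𝒟.carrier) (Ψ : (i : Fin N) → (B i).domain → 𝒟.carrier)
      (O : Set 𝒟.carrier), Prop} :
    (∀ p : FinalEraPackage 𝒟,
        Q p.N p.M p.a p.T p.δ p.V p.C₁ p.C₂ p.ρ₀ p.κ p.ξ p.β p.U₀ p.B₀ p.B p.Ψ₀ p.Ψ p.O) ↔
      ∀ (N : ℕ) (M a : Fin N → ℝ) (T δ V C₁ C₂ ρ₀ κ : ℝ) (ξ : Fin N → ℝ → E3) (β : ℝ → ℝ)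
        (U₀ : Opens E4) (B₀ : ModelBackground) (B : Fin N → ModelBackground)
        (Ψ₀ : B₀.domain → 𝒟.carrier) (Ψ : (i : Fin N) → (B i).domain → 𝒟.carrier)
        (O : Set 𝒟.carrier), 𝒟.IsFinalEra N M a T δ V C₁ C₂ ρ₀ κ ξ β U₀ B₀ B Ψ₀ Ψ O →
        Q N M a T δ V C₁ C₂ ρ₀ κ ξ β U₀ B₀ B Ψ₀ Ψ O :=
  ⟨fun H _ _ _ _ _ _ _ _ _ _ _ _ _ _ _ _ _ _ h ↦ H (ofIsFinalEra h), fun H p ↦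
    H p.N p.M p.a p.T p.δ p.V p.C₁ p.C₂ p.ρ₀ p.κ p.ξ p.β p.U₀ p.B₀ p.B p.Ψ₀ p.Ψ p.O p.isFinalEra⟩

/-- Existential companion of `forall_iff`: some final-era package has data satisfying `Q` iff
some tuple of binders satisfies the inline form together with `Q`. Dafermos–Luk,
arXiv:1710.01722, p. 8 (the picture; no printed formulation). [cite: DafermosLuk2017, p. 8] -/
theorem exists_iff
    {Q : ∀ (N : ℕ) (M a : Fin N → ℝ) (T δ V C₁ C₂ ρ₀ κ : ℝ) (ξ : Fin N → ℝ → E3) (β : ℝ → ℝ)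
      (U₀ : Opens E4) (B₀ : ModelBackground) (B : Fin N → ModelBackground)
      (Ψ₀ : B₀.domain → 𝒟.carrier) (Ψ : (i : Fin N) → (B i).domain → 𝒟.carrier)
      (O : Set 𝒟.carrier), Prop} :
    (∃ p : FinalEraPackage 𝒟,
        Q p.N p.M p.a p.T p.δ p.V p.C₁ p.C₂ p.ρ₀ p.κ p.ξ p.β p.U₀ p.B₀ p.B p.Ψ₀ p.Ψ p.O) ↔
      ∃ (N : ℕ) (M a : Fin N → ℝ) (T δ V C₁ C₂ ρ₀ κ : ℝ) (ξ : Fin N → ℝ → E3) (β : ℝ → ℝ)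
        (U₀ : Opens E4) (B₀ : ModelBackground) (B : Fin N → ModelBackground)
        (Ψ₀ : B₀.domain → 𝒟.carrier) (Ψ : (i : Fin N) → (B i).domain → 𝒟.carrier)
        (O : Set 𝒟.carrier), 𝒟.IsFinalEra N M a T δ V C₁ C₂ ρ₀ κ ξ β U₀ B₀ B Ψ₀ Ψ O ∧
        Q N M a T δ V C₁ C₂ ρ₀ κ ξ β U₀ B₀ B Ψ₀ Ψ O :=
  ⟨fun ⟨p, hQ⟩ ↦ ⟨p.N, p.M, p.a, p.T, p.δ, p.V, p.C₁, p.C₂, p.ρ₀, p.κ, p.ξ, p.β, p.U₀, p.B₀, p.B,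
    p.Ψ₀, p.Ψ, p.O, p.isFinalEra, hQ⟩,
    fun ⟨_, _, _, _, _, _, _, _, _, _, _, _, _, _, _, _, _, _, h, hQ⟩ ↦ ⟨ofIsFinalEra h, hQ⟩⟩

/-- Sanity API: the certified-zone radius `2ρ₀` of a package is positive. [folklore] -/
theorem two_mul_ρ₀_pos (p : FinalEraPackage 𝒟) : 0 < 2 * p.ρ₀ :=
  mul_pos two_pos p.ρ₀_pos

/-- Sanity API: the speed bound of a package lies in `[0, 1)`. [folklore] -/
theorem V_mem_Ico (p : FinalEraPackage 𝒟) : p.V ∈ Ico (0 : ℝ) 1 :=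
  ⟨p.V_nonneg, p.V_lt_one⟩

/-- Sanity API (W3 at `s = t`): the separation of two holes is controlled from below by the
floor `δ > 0` after `T`, so distinct worldlines never meet there. [folklore] -/
theorem ξ_ne (p : FinalEraPackage 𝒟) {t : ℝ} (ht : p.T ≤ t) {i j : Fin p.N} (hij : i ≠ j) :
    p.ξ i t ≠ p.ξ j t := fun h ↦ by
  have hle := p.le_norm_sub t ht i j hij
  rw [h, sub_self, norm_zero] at hle
  exact absurd hle (not_le.mpr p.δ_pos)

end FinalEraPackage

end Literature.Geometry.Lorentzian

end
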